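import Summits.Ventures.YMGap.RobustBall.LocalSourceResponse
import Summits.Ventures.YMGap.RobustBall.LocalSourceLoops
import Mathlib.Analysis.Calculus.Deriv.MeanValue
import HarnessLib

/-!
# Venture YMGap, track ROBUST-BALL (Y2) — LOCAL EXPECTATIONS ARE REAL-ANALYTIC IN EVERY LOCAL COUPLING, AND THE SOURCE ENERGY'S
# EXPECTATION IS MONOTONE IN THE SOURCE STRENGTH (Le Chatelier)

HONEST FRAMING. WHAT THIS IS: a venture file (cell `pub-ymgap`, track Y2 ROBUST-BALL, seat rb-p1, theorems only), the analytic
upgrade of `LocalSourceResponse.lean` (there: `C¹` with the Feynman–Hellmann derivative).  For a probability measure `μ`, a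
bounded measurable `H` and a bounded measurable `F`, the tilted expectation `t ↦ ∫ F d(μ.tilted (t H))` is the quotient
`(∫ (F + C) e^{tH} dμ − C ∫ e^{tH} dμ)/∫ e^{tH} dμ` of moment generating functions (the first one for the finite measure
`(F + C)·μ`, `C ≥ sup|F|`), all of which are real-analytic on the whole line (Mathlib `analyticAt_mgf`, the integrability
interval of `e^{tH}` being `ℝ` for bounded `H`) with a positive denominator — hence
* (tool file `TiltedResponse.lean`) `analyticAt_integral_tilted_of_bounded` — `t ↦ ∫ F d(μ.tilted (−t H))` is REAL-ANALYTIC AT EVERY REAL `t`;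
and, composed with `LocalSourceOneState[S].lean` (every DLR state of `W + t·V` is `μ.tilted (−t H^V)`):
* `analyticAt_integral_of_mem_perturbedGibbsMeasures_add_smul` (tier 1, listed supports) and
  `analyticAt_integral_of_mem_perturbedGibbsMeasuresS_add_smul` (tier 2, link-summable members) — for an adapted bounded
  member `W` with exactly one DLR state, every source `V` with finitely many listed terms, every selection
  `ν t ∈ 𝒢(W + t·V)` and every bounded measurable `F`, THE RESPONSE FUNCTION `t ↦ ∫ F dν_t` IS REAL-ANALYTIC ON ALL OF `ℝ`
  (`AnalyticAt ℝ` at every point): in the classical sense there is NO PHASE TRANSITION OF ANY ORDER in any local coupling;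
* ball forms `analyticAt_integral_of_uniformMassGapOnBallZdG` (ds-2's gauge-invariant ball),
  `analyticAt_integral_of_uniformMassGapOnBallZdS` (the weighted tier-2 ball), and the Wilson point with one loop of any
  strength `su2_wilson_singleLoop_analyticAt_upTo_oneThird` (`SU(2)`, `ℤ⁴`, `0 ≤ β_W ≤ 1/3`: `t ↦ ⟨F⟩_{β_W, t·Re tr U_w/2}` is
  real-analytic on `ℝ` for every closed walk `w` and every bounded measurable `F`).
* LE CHATELIER (second part of the file): `hasDerivAt_sourceEnergy[S]_eq_neg_variance` (`d/ds ⟨H^V⟩_{W+sV} = −Var_{ν_s}(H^V)`),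
  ★ `antitone_sourceEnergy[S]` (`s ↦ ⟨H^V⟩_{W+sV}` non-increasing on `ℝ`), `antitone_sourceEnergy_of_uniformMassGapOnBallZdG`,
  `su2_wilson_singleLoop_expectation_antitone_upTo_oneThird` (the one-loop expectation is monotone in its own coupling).
WHAT THIS IS NOT: analyticity / monotonicity in a LOCAL coupling only (finitely many terms) — nothing about analyticity in `β` or in a
translation-invariant coupling (that is the free-energy / pressure lane of ds-1 and rb-p2); lattice, strong coupling (the
rows); nothing about the continuum limit or a Clay-sense mass gap.  Source of the abstract step: B. Simon, The Statistical
Mechanics of Lattice Gases I (1993), §II.1 (finite-volume Gibbs expectations are ratios of entire functions).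
-/

noncomputable section

open MeasureTheory Function Finset Real ProbabilityTheory
open scoped NNReal ENNReal
open Literature.Probability.LatticeModels
open Literature.MathematicalPhysics.QuantumLattice
open Literature.MathematicalPhysics.QuantumFieldTheory hiding ZdEdge Site

namespace Summit.Ventures.YMGap.RobustBall

variable {d N : ℕ}


/-! ### Tier 1 (listed supports): the response function is real-analytic on `ℝ` -/

section General

variable {G : Type*} [Group G] [TopologicalSpace G] [IsTopologicalGroup G] [CompactSpace G]
  [MeasurableSpace G] [BorelSpace G] [SecondCountableTopology G] [T2Space G] (ρ : G →* Matrix (Fin N) (Fin N) ℂ)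

/-- **NO PHASE TRANSITION OF ANY ORDER IN A LOCAL COUPLING (tier 1).** Continuous `ρ`, compact second-countable `G`, adapted
bounded `W` listed by `supp` with at most one DLR state `μ ∈ 𝒢(W)`, adapted bounded source `V` listed by `suppV ⊆ T`: for
EVERY selection `ν t ∈ 𝒢(W + t·V)` and every bounded measurable `F`, `t ↦ ∫ F dν_t` is real-analytic at every `t₀ ∈ ℝ`. -/
theorem analyticAt_integral_of_mem_perturbedGibbsMeasures_add_smul (hρ : Continuous ρ) (β : ℝ)
    {W : Potential (ZdEdge d) G} (hW : W.IsAdapted) (hWb : ∀ X, ∃ C, ∀ U, |W X U| ≤ C)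
    {supp : Finset (ZdEdge d) → Finset (Finset (ZdEdge d))} (hsupp : W.IsSupportedBy supp)
    {V : Potential (ZdEdge d) G} (hV : V.IsAdapted) (hVb : ∀ X, ∃ C, ∀ U, |V X U| ≤ C)
    {suppV : Finset (ZdEdge d) → Finset (Finset (ZdEdge d))} (hsuppV : V.IsSupportedBy suppV)
    {T : Finset (Finset (ZdEdge d))} (hT : ∀ Λ, suppV Λ ⊆ T)
    (huniq : (perturbedGibbsMeasures ρ β W supp).Subsingleton)
    {μ : Measure (LGConfig d G)} (hμ : μ ∈ perturbedGibbsMeasures ρ β W supp)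
    {ν : ℝ → Measure (LGConfig d G)} (hν : ∀ s, ν s ∈ perturbedGibbsMeasures ρ β (W + s • V) (fun Λ => supp Λ ∪ suppV Λ))
    {F : LGConfig d G → ℝ} (hFm : Measurable F) {C : ℝ} (hFb : ∀ U, |F U| ≤ C) (t₀ : ℝ) :
    AnalyticAt ℝ (fun s => ∫ U, F U ∂(ν s)) t₀ := by
  haveI := (show IsGibbsMeasure _ μ from hμ).isProbabilityMeasure
  have hνs : ∀ s, ν s = μ.tilted fun U => -s * ∑ A ∈ T, V A U := fun s => by
    have h := hν s
    rw [perturbedGibbsMeasures_add_smul_eq_singleton ρ hρ β hW hWb hsupp hV hVb hsuppV hT huniq hμ s] at h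
    exact h
  choose CV hCV using hVb
  have hHm : Measurable fun U : LGConfig d G => ∑ A ∈ T, V A U := Finset.measurable_sum _ fun A _ => (hV A).2
  have hHb : ∀ U : LGConfig d G, |∑ A ∈ T, V A U| ≤ ∑ A ∈ T, CV A := fun U =>
    (Finset.abs_sum_le_sum_abs _ _).trans (Finset.sum_le_sum fun A _ => hCV A U)
  have hfun : (fun s => ∫ U, F U ∂(ν s)) = fun s : ℝ => ∫ U, F U ∂(μ.tilted fun U => -s * ∑ A ∈ T, V A U) :=
    funext fun s => by rw [hνs s]
  rw [hfun]
  exact analyticAt_integral_tilted_of_bounded hHm hHb hFm hFb t₀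

end General

/-! ### Tier 2 (link-summable members) -/

section TierTwo

variable {G : Type*} [Group G] [TopologicalSpace G] [IsTopologicalGroup G] [CompactSpace G]
  [MeasurableSpace G] [BorelSpace G] [SecondCountableTopology G] [T2Space G] (ρ : G →* Matrix (Fin N) (Fin N) ℂ)

/-- **NO PHASE TRANSITION OF ANY ORDER IN A LOCAL COUPLING (tier 2)**: link-summable `W` with continuous own-link terms and at
most one DLR state `μ`; source `V` with continuous own-link terms listed by `suppV ⊆ T`; then for every selection
`ν t ∈ 𝒢_S(W + t·V)` and every bounded measurable `F`, `t ↦ ∫ F dν_t` is real-analytic at every `t₀ ∈ ℝ`. -/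
theorem analyticAt_integral_of_mem_perturbedGibbsMeasuresS_add_smul (hρ : Continuous ρ) (β : ℝ)
    {W : Potential (ZdEdge d) G} {B : Finset (ZdEdge d) → ℝ} (hW : IsLinkSummable W B) (hWc : ∀ X, Continuous (W X))
    (hWdep : ∀ X, DependsOn (W X) (↑X : Set (ZdEdge d)))
    {V : Potential (ZdEdge d) G} (hVc : ∀ X, Continuous (V X)) (hVdep : ∀ X, DependsOn (V X) (↑X : Set (ZdEdge d)))
    {suppV : Finset (ZdEdge d) → Finset (Finset (ZdEdge d))} (hsuppV : V.IsSupportedBy suppV)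
    {T : Finset (Finset (ZdEdge d))} (hT : ∀ Λ, suppV Λ ⊆ T)
    (huniq : (perturbedGibbsMeasuresS ρ β W).Subsingleton)
    {μ : Measure (LGConfig d G)} (hμ : μ ∈ perturbedGibbsMeasuresS ρ β W)
    {ν : ℝ → Measure (LGConfig d G)} (hν : ∀ s, ν s ∈ perturbedGibbsMeasuresS ρ β (W + s • V))
    {F : LGConfig d G → ℝ} (hFm : Measurable F) {C : ℝ} (hFb : ∀ U, |F U| ≤ C) (t₀ : ℝ) :
    AnalyticAt ℝ (fun s => ∫ U, F U ∂(ν s)) t₀ := by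
  haveI := (show IsGibbsMeasure _ μ from hμ).isProbabilityMeasure
  have hνs : ∀ s, ν s = μ.tilted fun U => -s * ∑ A ∈ T, V A U := fun s => by
    have h := hν s
    rw [perturbedGibbsMeasuresS_add_smul_eq_singleton ρ hρ β hW hWc hWdep hVc hVdep hsuppV hT huniq hμ s] at h
    exact h
  choose CV hCV using fun X => exists_bound_of_continuous (hVc X)
  have hHm : Measurable fun U : LGConfig d G => ∑ A ∈ T, V A U := Finset.measurable_sum _ fun A _ => (hVc A).measurable
  have hHb : ∀ U : LGConfig d G, |∑ A ∈ T, V A U| ≤ ∑ A ∈ T, CV A := fun U =>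
    (Finset.abs_sum_le_sum_abs _ _).trans (Finset.sum_le_sum fun A _ => hCV A U)
  have hfun : (fun s => ∫ U, F U ∂(ν s)) = fun s : ℝ => ∫ U, F U ∂(μ.tilted fun U => -s * ∑ A ∈ T, V A U) :=
    funext fun s => by rw [hνs s]
  rw [hfun]
  exact analyticAt_integral_tilted_of_bounded hHm hHb hFm hFb t₀

end TierTwo

/-! ### Ball forms -/

section Balls

/-- **ON ds-2's GAUGE-INVARIANT BALL**: for every member `(W, supp)` of `MemBallZdG ε₀ ε₁ R` of a ball with
`UniformMassGapOnBallZdG d N β ε₀ ε₁ R m A`, every adapted bounded source `V` with finitely many listed terms, every selection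
`ν t ∈ 𝒢(W + t·V)` and every bounded measurable `F`: `t ↦ ∫ F dν_t` is real-analytic at every `t₀ ∈ ℝ`. -/
theorem analyticAt_integral_of_uniformMassGapOnBallZdG {β ε₀ ε₁ m A : ℝ} {R : ℕ}
    (h : UniformMassGapOnBallZdG d N β ε₀ ε₁ R m A)
    {W : Potential (ZdEdge d) (SUN N)} {supp : Finset (ZdEdge d) → Finset (Finset (ZdEdge d))}
    (hW : MemBallZdG ε₀ ε₁ R W supp)
    {V : Potential (ZdEdge d) (SUN N)} (hV : V.IsAdapted) (hVb : ∀ X, ∃ C, ∀ U, |V X U| ≤ C)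
    {suppV : Finset (ZdEdge d) → Finset (Finset (ZdEdge d))} (hsuppV : V.IsSupportedBy suppV)
    {T : Finset (Finset (ZdEdge d))} (hT : ∀ Λ, suppV Λ ⊆ T)
    {ν : ℝ → Measure (LGConfig d (SUN N))}
    (hν : ∀ s, ν s ∈ perturbedGibbsMeasures (d := d) (fundamentalRep (Fin N)) (N * β) (W + s • V) (fun Λ => supp Λ ∪ suppV Λ))
    {F : LGConfig d (SUN N) → ℝ} (hFm : Measurable F) {C : ℝ} (hFb : ∀ U, |F U| ≤ C) (t₀ : ℝ) :
    AnalyticAt ℝ (fun s => ∫ U, F U ∂(ν s)) t₀ := by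
  haveI : SecondCountableTopology (Matrix (Fin N) (Fin N) ℂ) :=
    inferInstanceAs (SecondCountableTopology (Fin N → Fin N → ℂ))
  haveI : SecondCountableTopology (SUN N) := Topology.IsEmbedding.subtypeVal.secondCountableTopology
  have hWa : W.IsAdapted := fun X => ⟨hW.dependsOn X, (hW.continuous X).measurable⟩
  have hWb : ∀ X, ∃ C, ∀ U, |W X U| ≤ C := fun X => exists_bound_of_continuous (hW.continuous X)
  obtain ⟨μ, hμ⟩ := (h.2 W supp hW).1.2
  exact analyticAt_integral_of_mem_perturbedGibbsMeasures_add_smul (fundamentalRep (Fin N)) (continuous_fundamentalRep (Fin N))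
    (N * β) hWa hWb hW.supportedBy hV hVb hsuppV hT (h.2 W supp hW).1.1 hμ hν hFm hFb t₀

/-- **ON THE WEIGHTED TIER-2 BALL** (`UniformMassGapOnBallZdS d N β a Λ t m A`, member `W ∈ MemBallZdS a Λ t`): for every source
`V` with continuous own-link terms and finitely many listed terms, every selection `ν s ∈ 𝒢_S(W + s·V)` and every bounded
measurable `F`, `s ↦ ∫ F dν_s` is real-analytic at every `t₀ ∈ ℝ`. -/
theorem analyticAt_integral_of_uniformMassGapOnBallZdS {β a Λ t m A : ℝ} (h : UniformMassGapOnBallZdS d N β a Λ t m A)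
    {W : Potential (ZdEdge d) (SUN N)} (hW : MemBallZdS a Λ t W)
    {V : Potential (ZdEdge d) (SUN N)} (hVc : ∀ X, Continuous (V X)) (hVdep : ∀ X, DependsOn (V X) (↑X : Set (ZdEdge d)))
    {suppV : Finset (ZdEdge d) → Finset (Finset (ZdEdge d))} (hsuppV : V.IsSupportedBy suppV)
    {T : Finset (Finset (ZdEdge d))} (hT : ∀ Λ, suppV Λ ⊆ T)
    {ν : ℝ → Measure (LGConfig d (SUN N))}
    (hν : ∀ s, ν s ∈ perturbedGibbsMeasuresS (d := d) (fundamentalRep (Fin N)) (N * β) (W + s • V))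
    {F : LGConfig d (SUN N) → ℝ} (hFm : Measurable F) {C : ℝ} (hFb : ∀ U, |F U| ≤ C) (t₀ : ℝ) :
    AnalyticAt ℝ (fun s => ∫ U, F U ∂(ν s)) t₀ := by
  haveI : SecondCountableTopology (Matrix (Fin N) (Fin N) ℂ) :=
    inferInstanceAs (SecondCountableTopology (Fin N → Fin N → ℂ))
  haveI : SecondCountableTopology (SUN N) := Topology.IsEmbedding.subtypeVal.secondCountableTopology
  obtain ⟨B, hB⟩ := hW.summable
  obtain ⟨μ, hμ⟩ := (h.2 W hW).1.2
  exact analyticAt_integral_of_mem_perturbedGibbsMeasuresS_add_smul (fundamentalRep (Fin N)) (continuous_fundamentalRep (Fin N))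
    (N * β) hB hW.continuous hW.dependsOn hVc hVdep hsuppV hT (h.2 W hW).1.1 hμ hν hFm hFb t₀

/-- **THE `SU(2)` WILSON POINT ON `ℤ⁴`, `0 ≤ β_W ≤ 1/3`, ONE LOOP OF ANY STRENGTH: `t ↦ ⟨F⟩_{β_W, t·Re tr U_w/2}` IS REAL-ANALYTIC
ON ALL OF `ℝ`** (for every closed walk `w`, every selection `ν t` of DLR states of the action with `t · Re tr U_w/2` inserted —
each unique — and every bounded measurable `F`). -/
theorem su2_wilson_singleLoop_analyticAt_upTo_oneThird {βW : ℝ} (h0 : 0 ≤ βW) (h1 : βW ≤ 1 / 3)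
    {x : Literature.Probability.LatticeModels.Site 4} (w : (zdGraph 4).Walk x x)
    {ν : ℝ → Measure (LGConfig 4 (SUN 2))}
    (hν : ∀ t, ν t ∈ perturbedGibbsMeasures (d := 4) (fundamentalRep (Fin 2)) (2 * (βW / 4))
      (loopFamilyAction 2 (fun _ : Unit => (⟨x, w⟩ : ZdLoop 4)) (fun _ => t))
      (loopSupp (fun _ : Unit => (⟨x, w⟩ : ZdLoop 4))))
    {F : LGConfig 4 (SUN 2) → ℝ} (hFm : Measurable F) {C : ℝ} (hFb : ∀ U, |F U| ≤ C) (t₀ : ℝ) :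
    AnalyticAt ℝ (fun t => ∫ U, F U ∂(ν t)) t₀ := by
  classical
  obtain ⟨m, -, hball⟩ := su2_uniformStar_upTo_oneThird
  have hmem : MemBallZdG (N := 2) (d := 4) (3 / 125) (3 / 250) 0 0 (fun _ => (∅ : Finset (Finset (ZdEdge 4)))) :=
    memBallZdG_zero (by norm_num) (by norm_num) 0
  set γ : Unit → ZdLoop 4 := fun _ => ⟨x, w⟩ with hγ
  have hV := memBallZd_loopFamilyAction_fintype (N := 2) γ fun _ => (1 : ℝ)
  have hVa : (loopFamilyAction (d := 4) 2 γ fun _ => (1 : ℝ)).IsAdapted := fun X =>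
    ⟨hV.dependsOn X, (hV.continuous X).measurable⟩
  have hVb : ∀ X, ∃ C, ∀ U, |loopFamilyAction (d := 4) 2 γ (fun _ => (1 : ℝ)) X U| ≤ C := fun X =>
    exists_bound_of_continuous (hV.continuous X)
  have hT : ∀ Λ, loopSupp γ Λ ⊆ Finset.univ.image fun i => walkEdges (γ i).walk := fun Λ =>
    Finset.image_subset_image (Finset.subset_univ _)
  have hfam : ∀ t : ℝ, loopFamilyAction (d := 4) 2 γ (fun _ => t) = 0 + t • loopFamilyAction (d := 4) 2 γ fun _ => (1 : ℝ) := by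
    intro t
    rw [zero_add, ← loopFamilyAction_smul]
    simp only [mul_one]
  have hν' : ∀ t, ν t ∈ perturbedGibbsMeasures (d := 4) (fundamentalRep (Fin 2)) (2 * (βW / 4))
      (0 + t • loopFamilyAction (d := 4) 2 γ fun _ => (1 : ℝ)) (fun Λ => (∅ : Finset (Finset (ZdEdge 4))) ∪ loopSupp γ Λ) := by
    intro t
    have h := hν t
    rw [hfam t] at h
    simpa only [Finset.empty_union] using h
  exact analyticAt_integral_of_uniformMassGapOnBallZdG (hball βW h0 h1 0) hmem hVa hVb hV.supportedBy hT hν' hFm hFb t₀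

end Balls


/-! ## Le Chatelier: the source energy's expectation is monotone in the source strength -/

/-! ### Tier 1 (listed supports), monotone form -/

section MonotoneGeneral

variable {G : Type*} [Group G] [TopologicalSpace G] [IsTopologicalGroup G] [CompactSpace G]
  [MeasurableSpace G] [BorelSpace G] [SecondCountableTopology G] [T2Space G] (ρ : G →* Matrix (Fin N) (Fin N) ℂ)

/-- **`d/ds ⟨H^V⟩_{W+sV} = −Var_{ν_s}(H^V)`** (Feynman–Hellmann with the source energy as observable). -/
theorem hasDerivAt_sourceEnergy_eq_neg_variance (hρ : Continuous ρ) (β : ℝ)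
    {W : Potential (ZdEdge d) G} (hW : W.IsAdapted) (hWb : ∀ X, ∃ C, ∀ U, |W X U| ≤ C)
    {supp : Finset (ZdEdge d) → Finset (Finset (ZdEdge d))} (hsupp : W.IsSupportedBy supp)
    {V : Potential (ZdEdge d) G} (hV : V.IsAdapted) (hVb : ∀ X, ∃ C, ∀ U, |V X U| ≤ C)
    {suppV : Finset (ZdEdge d) → Finset (Finset (ZdEdge d))} (hsuppV : V.IsSupportedBy suppV)
    {T : Finset (Finset (ZdEdge d))} (hT : ∀ Λ, suppV Λ ⊆ T)
    (huniq : (perturbedGibbsMeasures ρ β W supp).Subsingleton)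
    {μ : Measure (LGConfig d G)} (hμ : μ ∈ perturbedGibbsMeasures ρ β W supp)
    {ν : ℝ → Measure (LGConfig d G)} (hν : ∀ s, ν s ∈ perturbedGibbsMeasures ρ β (W + s • V) (fun Λ => supp Λ ∪ suppV Λ))
    (b : ℝ) :
    HasDerivAt (fun s => ∫ U, (∑ A ∈ T, V A U) ∂(ν s)) (-Var[fun U => ∑ A ∈ T, V A U; ν b]) b := by
  choose CV hCV using hVb
  have hHm : Measurable fun U : LGConfig d G => ∑ A ∈ T, V A U := Finset.measurable_sum _ fun A _ => (hV A).2
  have hHb : ∀ U : LGConfig d G, |∑ A ∈ T, V A U| ≤ ∑ A ∈ T, CV A := fun U =>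
    (Finset.abs_sum_le_sum_abs _ _).trans (Finset.sum_le_sum fun A _ => hCV A U)
  have h := hasDerivAt_integral_of_mem_perturbedGibbsMeasures_add_smul ρ hρ β hW hWb hsupp hV (fun X => ⟨CV X, hCV X⟩) hsuppV hT
    huniq hμ hν hHm hHb b
  have hae : AEMeasurable (fun U : LGConfig d G => ∑ A ∈ T, V A U) (ν b) := hHm.aemeasurable
  rw [covariance_self hae] at h
  exact h

/-- ★ **LE CHATELIER: THE EXPECTATION OF THE SOURCE ENERGY IS NON-INCREASING IN THE SOURCE STRENGTH** — for every selection
`ν s ∈ 𝒢(W + s·V)`, `s ↦ ∫ H^V dν_s` is antitone on `ℝ`. -/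
theorem antitone_sourceEnergy (hρ : Continuous ρ) (β : ℝ)
    {W : Potential (ZdEdge d) G} (hW : W.IsAdapted) (hWb : ∀ X, ∃ C, ∀ U, |W X U| ≤ C)
    {supp : Finset (ZdEdge d) → Finset (Finset (ZdEdge d))} (hsupp : W.IsSupportedBy supp)
    {V : Potential (ZdEdge d) G} (hV : V.IsAdapted) (hVb : ∀ X, ∃ C, ∀ U, |V X U| ≤ C)
    {suppV : Finset (ZdEdge d) → Finset (Finset (ZdEdge d))} (hsuppV : V.IsSupportedBy suppV)
    {T : Finset (Finset (ZdEdge d))} (hT : ∀ Λ, suppV Λ ⊆ T)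
    (huniq : (perturbedGibbsMeasures ρ β W supp).Subsingleton)
    {μ : Measure (LGConfig d G)} (hμ : μ ∈ perturbedGibbsMeasures ρ β W supp)
    {ν : ℝ → Measure (LGConfig d G)} (hν : ∀ s, ν s ∈ perturbedGibbsMeasures ρ β (W + s • V) (fun Λ => supp Λ ∪ suppV Λ)) :
    Antitone fun s => ∫ U, (∑ A ∈ T, V A U) ∂(ν s) := by
  have hd := fun b => hasDerivAt_sourceEnergy_eq_neg_variance ρ hρ β hW hWb hsupp hV hVb hsuppV hT huniq hμ hν b
  refine antitone_of_deriv_nonpos (fun b => (hd b).differentiableAt) fun b => ?_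
  rw [(hd b).deriv]
  exact neg_nonpos.2 (variance_nonneg _ _)

end MonotoneGeneral

/-! ### Tier 2 (link-summable members) -/

section MonotoneTierTwo

variable {G : Type*} [Group G] [TopologicalSpace G] [IsTopologicalGroup G] [CompactSpace G]
  [MeasurableSpace G] [BorelSpace G] [SecondCountableTopology G] [T2Space G] (ρ : G →* Matrix (Fin N) (Fin N) ℂ)

/-- **Tier 2: `d/ds ⟨H^V⟩ = −Var_{ν_s}(H^V)`** for link-summable members. -/
theorem hasDerivAt_sourceEnergyS_eq_neg_variance (hρ : Continuous ρ) (β : ℝ)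
    {W : Potential (ZdEdge d) G} {B : Finset (ZdEdge d) → ℝ} (hW : IsLinkSummable W B) (hWc : ∀ X, Continuous (W X))
    (hWdep : ∀ X, DependsOn (W X) (↑X : Set (ZdEdge d)))
    {V : Potential (ZdEdge d) G} (hVc : ∀ X, Continuous (V X)) (hVdep : ∀ X, DependsOn (V X) (↑X : Set (ZdEdge d)))
    {suppV : Finset (ZdEdge d) → Finset (Finset (ZdEdge d))} (hsuppV : V.IsSupportedBy suppV)
    {T : Finset (Finset (ZdEdge d))} (hT : ∀ Λ, suppV Λ ⊆ T)
    (huniq : (perturbedGibbsMeasuresS ρ β W).Subsingleton)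
    {μ : Measure (LGConfig d G)} (hμ : μ ∈ perturbedGibbsMeasuresS ρ β W)
    {ν : ℝ → Measure (LGConfig d G)} (hν : ∀ s, ν s ∈ perturbedGibbsMeasuresS ρ β (W + s • V)) (b : ℝ) :
    HasDerivAt (fun s => ∫ U, (∑ A ∈ T, V A U) ∂(ν s)) (-Var[fun U => ∑ A ∈ T, V A U; ν b]) b := by
  choose CV hCV using fun X => exists_bound_of_continuous (hVc X)
  have hHm : Measurable fun U : LGConfig d G => ∑ A ∈ T, V A U := Finset.measurable_sum _ fun A _ => (hVc A).measurable
  have hHb : ∀ U : LGConfig d G, |∑ A ∈ T, V A U| ≤ ∑ A ∈ T, CV A := fun U =>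
    (Finset.abs_sum_le_sum_abs _ _).trans (Finset.sum_le_sum fun A _ => hCV A U)
  obtain ⟨-, h⟩ := hasDerivAt_integral_of_mem_perturbedGibbsMeasuresS_add_smul ρ hρ β hW hWc hWdep hVc hVdep hsuppV hT huniq hμ hν
    hHm hHb b
  have hae : AEMeasurable (fun U : LGConfig d G => ∑ A ∈ T, V A U) (ν b) := hHm.aemeasurable
  rw [covariance_self hae] at h
  exact h

/-- ★ **Tier 2, LE CHATELIER**: `s ↦ ∫ H^V dν_s` is antitone on `ℝ`. -/
theorem antitone_sourceEnergyS (hρ : Continuous ρ) (β : ℝ)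
    {W : Potential (ZdEdge d) G} {B : Finset (ZdEdge d) → ℝ} (hW : IsLinkSummable W B) (hWc : ∀ X, Continuous (W X))
    (hWdep : ∀ X, DependsOn (W X) (↑X : Set (ZdEdge d)))
    {V : Potential (ZdEdge d) G} (hVc : ∀ X, Continuous (V X)) (hVdep : ∀ X, DependsOn (V X) (↑X : Set (ZdEdge d)))
    {suppV : Finset (ZdEdge d) → Finset (Finset (ZdEdge d))} (hsuppV : V.IsSupportedBy suppV)
    {T : Finset (Finset (ZdEdge d))} (hT : ∀ Λ, suppV Λ ⊆ T)
    (huniq : (perturbedGibbsMeasuresS ρ β W).Subsingleton)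
    {μ : Measure (LGConfig d G)} (hμ : μ ∈ perturbedGibbsMeasuresS ρ β W)
    {ν : ℝ → Measure (LGConfig d G)} (hν : ∀ s, ν s ∈ perturbedGibbsMeasuresS ρ β (W + s • V)) :
    Antitone fun s => ∫ U, (∑ A ∈ T, V A U) ∂(ν s) := by
  have hd := fun b => hasDerivAt_sourceEnergyS_eq_neg_variance ρ hρ β hW hWc hWdep hVc hVdep hsuppV hT huniq hμ hν b
  refine antitone_of_deriv_nonpos (fun b => (hd b).differentiableAt) fun b => ?_
  rw [(hd b).deriv]
  exact neg_nonpos.2 (variance_nonneg _ _)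

end MonotoneTierTwo

/-! ### The gauge-invariant ball and the Wilson point with one loop -/

section MonotoneBalls

/-- **ON ds-2's GAUGE-INVARIANT BALL** (`UniformMassGapOnBallZdG d N β ε₀ ε₁ R m A`, member `(W, supp)`): for every adapted bounded local source
`V` and every selection `ν s ∈ 𝒢(W + s·V)`, `s ↦ ∫ H^V dν_s` is non-increasing on `ℝ`. -/
theorem antitone_sourceEnergy_of_uniformMassGapOnBallZdG {β ε₀ ε₁ m A : ℝ} {R : ℕ}
    (h : UniformMassGapOnBallZdG d N β ε₀ ε₁ R m A)
    {W : Potential (ZdEdge d) (SUN N)} {supp : Finset (ZdEdge d) → Finset (Finset (ZdEdge d))}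
    (hW : MemBallZdG ε₀ ε₁ R W supp)
    {V : Potential (ZdEdge d) (SUN N)} (hV : V.IsAdapted) (hVb : ∀ X, ∃ C, ∀ U, |V X U| ≤ C)
    {suppV : Finset (ZdEdge d) → Finset (Finset (ZdEdge d))} (hsuppV : V.IsSupportedBy suppV)
    {T : Finset (Finset (ZdEdge d))} (hT : ∀ Λ, suppV Λ ⊆ T)
    {ν : ℝ → Measure (LGConfig d (SUN N))}
    (hν : ∀ s, ν s ∈ perturbedGibbsMeasures (d := d) (fundamentalRep (Fin N)) (N * β) (W + s • V) (fun Λ => supp Λ ∪ suppV Λ)) :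
    Antitone fun s => ∫ U, (∑ A ∈ T, V A U) ∂(ν s) := by
  haveI : SecondCountableTopology (Matrix (Fin N) (Fin N) ℂ) :=
    inferInstanceAs (SecondCountableTopology (Fin N → Fin N → ℂ))
  haveI : SecondCountableTopology (SUN N) := Topology.IsEmbedding.subtypeVal.secondCountableTopology
  have hWa : W.IsAdapted := fun X => ⟨hW.dependsOn X, (hW.continuous X).measurable⟩
  have hWb : ∀ X, ∃ C, ∀ U, |W X U| ≤ C := fun X => exists_bound_of_continuous (hW.continuous X)
  obtain ⟨μ, hμ⟩ := (h.2 W supp hW).1.2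
  exact antitone_sourceEnergy (fundamentalRep (Fin N)) (continuous_fundamentalRep (Fin N)) (N * β) hWa hWb hW.supportedBy hV hVb hsuppV hT
    (h.2 W supp hW).1.1 hμ hν

/-- ★ **THE `SU(2)` WILSON POINT ON `ℤ⁴`, `0 ≤ β_W ≤ 1/3`, ONE LOOP: THE LOOP EXPECTATION IS MONOTONE IN ITS OWN COUPLING.**  For every
closed walk `w` and every selection `ν t` of DLR states of the Wilson action with `t · Re tr U_w/2` inserted (each unique),
`t ↦ ∫ Re tr U_w/2 dν_t` is non-increasing on `ℝ` (Boltzmann weight `e^{−t·Re tr U_w/2}`: in the sign `c = −t` the loop expectation grows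
with the coupling that favours it). -/
theorem su2_wilson_singleLoop_expectation_antitone_upTo_oneThird {βW : ℝ} (h0 : 0 ≤ βW) (h1 : βW ≤ 1 / 3)
    {x : Literature.Probability.LatticeModels.Site 4} (w : (zdGraph 4).Walk x x)
    {ν : ℝ → Measure (LGConfig 4 (SUN 2))}
    (hν : ∀ t, ν t ∈ perturbedGibbsMeasures (d := 4) (fundamentalRep (Fin 2)) (2 * (βW / 4))
      (loopFamilyAction 2 (fun _ : Unit => (⟨x, w⟩ : ZdLoop 4)) (fun _ => t)) (loopSupp (fun _ : Unit => (⟨x, w⟩ : ZdLoop 4)))) :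
    Antitone fun t => ∫ U, loopTerm (d := 4) 2 1 w U ∂(ν t) := by
  classical
  obtain ⟨m, -, hball⟩ := su2_uniformStar_upTo_oneThird
  have hmem : MemBallZdG (N := 2) (d := 4) (3 / 125) (3 / 250) 0 0 (fun _ => (∅ : Finset (Finset (ZdEdge 4)))) :=
    memBallZdG_zero (by norm_num) (by norm_num) 0
  have hV := memBallZd_loopFamilyAction_fintype (N := 2) (fun _ : Unit => (⟨x, w⟩ : ZdLoop 4)) fun _ => (1 : ℝ)
  have hVa : (loopFamilyAction (d := 4) 2 (fun _ : Unit => (⟨x, w⟩ : ZdLoop 4)) fun _ => (1 : ℝ)).IsAdapted := fun X =>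
    ⟨hV.dependsOn X, (hV.continuous X).measurable⟩
  have hVb : ∀ X, ∃ C, ∀ U, |loopFamilyAction (d := 4) 2 (fun _ : Unit => (⟨x, w⟩ : ZdLoop 4)) (fun _ => (1 : ℝ)) X U| ≤ C := fun X =>
    exists_bound_of_continuous (hV.continuous X)
  have hT : ∀ Λ, loopSupp (fun _ : Unit => (⟨x, w⟩ : ZdLoop 4)) Λ ⊆
      (Finset.univ : Finset Unit).image fun i => walkEdges ((fun _ : Unit => (⟨x, w⟩ : ZdLoop 4)) i).walk := fun Λ =>
    Finset.image_subset_image (Finset.subset_univ _)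
  have hfam : ∀ t : ℝ, loopFamilyAction (d := 4) 2 (fun _ : Unit => (⟨x, w⟩ : ZdLoop 4)) (fun _ => t) =
      0 + t • loopFamilyAction (d := 4) 2 (fun _ : Unit => (⟨x, w⟩ : ZdLoop 4)) fun _ => (1 : ℝ) := by
    intro t
    rw [zero_add, ← loopFamilyAction_smul]
    simp only [mul_one]
  have hν' : ∀ t, ν t ∈ perturbedGibbsMeasures (d := 4) (fundamentalRep (Fin 2)) (2 * (βW / 4))
      (0 + t • loopFamilyAction (d := 4) 2 (fun _ : Unit => (⟨x, w⟩ : ZdLoop 4)) fun _ => (1 : ℝ))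
      (fun Λ => (∅ : Finset (Finset (ZdEdge 4))) ∪ loopSupp (fun _ : Unit => (⟨x, w⟩ : ZdLoop 4)) Λ) := by
    intro t
    have h := hν t
    rw [hfam t] at h
    simpa only [Finset.empty_union] using h
  have key := antitone_sourceEnergy_of_uniformMassGapOnBallZdG (hball βW h0 h1 0) hmem hVa hVb hV.supportedBy hT hν'
  have hH : (fun U : LGConfig 4 (SUN 2) => ∑ A ∈ (Finset.univ : Finset Unit).image
      (fun i => walkEdges ((fun _ : Unit => (⟨x, w⟩ : ZdLoop 4)) i).walk),
      loopFamilyAction (d := 4) 2 (fun _ : Unit => (⟨x, w⟩ : ZdLoop 4)) (fun _ => (1 : ℝ)) A U) = loopTerm (d := 4) 2 1 w :=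
    funext fun U => sum_singleLoop_source w U
  have hfun : (fun t => ∫ U, loopTerm (d := 4) 2 1 w U ∂(ν t)) = fun t => ∫ U, (∑ A ∈ (Finset.univ : Finset Unit).image
      (fun i => walkEdges ((fun _ : Unit => (⟨x, w⟩ : ZdLoop 4)) i).walk),
      loopFamilyAction (d := 4) 2 (fun _ : Unit => (⟨x, w⟩ : ZdLoop 4)) (fun _ => (1 : ℝ)) A U) ∂(ν t) := by
    funext t; rw [← hH]
  rw [hfun]
  exact key

end MonotoneBalls

end Summit.Ventures.YMGap.RobustBall

end
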